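import Summits.CriticalPhenomena.PercolationContinuityZ3.Theorems.Transplant.GrigorchukLamplighterFCScope
import Summits.CriticalPhenomena.PercolationContinuityZ3.Theorems.Transplant.GrigorchukBurnside
import Mathlib.GroupTheory.Nilpotent
import Mathlib.SetTheory.Cardinal.Finite
import HarnessLib

/-!
# SCOPE RECORD (fourth leg): `Γ₂ = ℤ ≀_X 𝔊` is NOT virtually nilpotent — so the rung-Q Cayley customers («AutCylinderWolf» `AutCyl.conj4_cayley_virtuallyNilpotent` /
# `conj4_cayley_of_isVirtuallyNilpotent`) have no input on any Cayley graph of `Γ₂`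

builds on p205010 (kernel theorem, internal audit signed; external expert review pending) — nothing in this file uses p205010; pure group theory, no percolation
statement, no node touched.  Lane `prim-bschramm`, seat `prim-bschramm-p3` gen 35 (DESIGN OWNER; `run/shared/lean/prim/bschramm/P3-NILPOTENT.md` §28.8: the scope
of the residual candidate `Cay(ℤ ≀_X 𝔊; a, b, c, d, s)`; legs 1–3 = «GrigorchukLamplighterCharacters» p592894 (U_s ✗), «…StandardGensNoGoHolds» p592041 (N3 ✗),
«GrigorchukLamplighterFCScope» p593551 (covering ✗); this is leg 4: rung Q's Cayley customer ✗ — so far 'by citation (intermediate growth)', now by PROOF and without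
any growth statement).  Helper file (`--supports stmt-CriticalPhenomena-4575 --as helper`).  Def-free.  THE ARGUMENT: `Γ₂` is infinite (it contains a copy of the
infinite `𝔊`, «GrigorchukBurnside» p594312), so a finite-index subgroup `N` is infinite, hence non-trivial; if `N` were nilpotent its centre would contain some `z ≠ 1`
(Mathlib `Group.IsNilpotent.center_ne_bot`), commuting with the finite-index `N` — contradicting FC(Γ₂) = 1 (`wreathZ_not_finiteIndex_of_commuting`, p593551).
NOTHING about growth (neither polynomial nor intermediate growth is claimed or used); nothing about `BenjaminiSchramm1996_conj4_endState`; `θ(p_c) = 0` on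
`Cay(ℤ ≀_X 𝔊; a, b, c, d, s)` stays NOT PROVED in the tree and not in print.
* `wreathZ_infinite`, **`wreathZ_not_nilpotent_of_finiteIndex (N) [N.FiniteIndex] : ¬ Group.IsNilpotent N`**, **`wreathZ_not_isVirtuallyNilpotent : ¬ Group.IsVirtuallyNilpotent ↥wreathZ`**.
[cite: BartholdiErschler2012, §2, §3.1 (Γ₂ = ℤ ≀_X 𝔊; the first Grigorchuk group)] [cite: Grigorchuk1980, the group is infinite] [cite: BenjaminiSchramm1996, §2 (Cayley graphs)]
-/

noncomputable section

namespace Summit.CriticalPhenomena.PercolationContinuityZ3.Theorems.Transplant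

namespace Grigorchuk

/-- **`Γ₂ = ℤ ≀_X 𝔊` is infinite** (it contains the tree copy of the infinite `𝔊`). [cite: Grigorchuk1980, the group is infinite] [cite: BartholdiErschler2012, §2] -/
theorem wreathZ_infinite : (wreathZ : Set (LampGroup ℤ)).Infinite := by
  have h := grigorchukGroup_infinite
  let e := h.natEmbedding
  refine Set.infinite_of_injective_forall_mem (f := fun m => (tree ((e m : Equiv.Perm Ray)) : LampGroup ℤ)) ?_ fun m => tree_mem_wreathZ (e m).2
  intro m m' hmm'
  have h1 : ((e m : Equiv.Perm Ray)) = (e m' : Equiv.Perm Ray) := SemidirectProduct.inr_injective hmm'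
  exact e.injective (Subtype.ext h1)

/-- **No finite-index subgroup of `Γ₂` is nilpotent.** [cite: BartholdiErschler2012, §2, §3.1] -/
theorem wreathZ_not_nilpotent_of_finiteIndex (N : Subgroup ↥wreathZ) [N.FiniteIndex] : ¬ Group.IsNilpotent N := by
  intro hN
  -- `Γ₂` is infinite, so the finite-index `N` is infinite, hence non-trivial
  haveI : Infinite ↥wreathZ := Set.infinite_coe_iff.2 wreathZ_infinite
  have hcard : Nat.card N = 0 := by
    have h := N.index_mul_card
    rw [Nat.card_eq_zero_of_infinite (α := ↥wreathZ)] at h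
    rcases Nat.mul_eq_zero.1 h with h0 | h0
    · exact absurd h0 Subgroup.FiniteIndex.index_ne_zero
    · exact h0
  haveI : Infinite N := by
    by_contra hfin
    rw [not_infinite_iff_finite] at hfin
    exact (Nat.card_pos (α := N)).ne' hcard
  -- a non-trivial central element of `N` commutes with the finite-index `N`: impossible in `Γ₂`
  obtain ⟨z, hz1⟩ := Subgroup.ne_bot_iff_exists_ne_one.1 (Group.IsNilpotent.center_ne_bot (G := N))
  have hzc := Subgroup.mem_center_iff.1 z.2
  have hz' : ((z : N) : ↥wreathZ) ≠ 1 := fun h => hz1 (Subtype.ext (Subtype.ext (by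
    have := congrArg (fun x : ↥wreathZ => (x : LampGroup ℤ)) h
    simpa using this)))
  refine wreathZ_not_finiteIndex_of_commuting ((z : N) : ↥wreathZ) hz' N (fun n hn => ?_) inferInstance
  have := hzc ⟨n, hn⟩
  exact congrArg (fun x : N => (x : ↥wreathZ)) this

/-- **`Γ₂ = ℤ ≀_X 𝔊` is not virtually nilpotent** (Mathlib's `Group.IsVirtuallyNilpotent`): the rung-Q Cayley customer `AutCyl.conj4_cayley_of_isVirtuallyNilpotent`
(«AutCylinderWolf») has no input for `Γ = Γ₂`. [cite: BartholdiErschler2012, §2, §3.1] [cite: BenjaminiSchramm1996, §2 (Cayley graphs)] -/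
theorem wreathZ_not_isVirtuallyNilpotent : ¬ Group.IsVirtuallyNilpotent ↥wreathZ := by
  rintro ⟨N, hN, hfi⟩
  haveI := hfi
  exact wreathZ_not_nilpotent_of_finiteIndex N hN

end Grigorchuk

end Summit.CriticalPhenomena.PercolationContinuityZ3.Theorems.Transplant

end
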